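import Mathlib.RepresentationTheory.Homological.ContCohomology.Functoriality
import Mathlib.NumberTheory.NumberField.Completion.FinitePlace
import Mathlib.NumberTheory.NumberField.Completion.InfinitePlace
import Mathlib.Algebra.Module.ZMod
import Mathlib.GroupTheory.Torsion
import Mathlib.LinearAlgebra.FreeModule.ModN
import Mathlib.LinearAlgebra.Dimension.Finrank
import Literature.NumberTheory.EllipticCurves.TateModule
import Literature.NumberTheory.EllipticCurves.GaloisAction
import Literature.NumberTheory.EllipticCurves.Sha
import Literature.NumberTheory.EllipticCurves.MordellWeil
import HarnessLib

-- provenance: harness21/H21/H21/Prelude/EllArithM/Selmer.lean @ 0c3bcbe (interim HEAD d8f2665); M5 mechanical rewrite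
/-!
# Selmer groups of a Weierstrass curve over a number field

Trunk T-ELLARITH-M (group G16, outline item C2 `Selmer`); notion `selmer_group_elliptic`.

For a Weierstrass curve `W` (an elliptic curve `E`) over a number field `K` and `n : ℤ`, the
`n`-Selmer group is
`Sel^(n)(E/K) = ker ( H¹(K, E[n]) → ∏_v H¹(K_v, E) )`,
the product over all places `v` of `K` (finite `v : HeightOneSpectrum (𝓞 K)` with
`K_v = v.adicCompletion K`, infinite `w : NumberField.InfinitePlace K` with `K_w = w.Completion`).
It is built *exactly* like `WeierstrassCurve.sha` (file `Sha`): `H¹(K, E[n])` is Mathlib's continuous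
cohomology `continuousCohomology 1` of the discrete `Γ_K`-module `E[n] = geomTorsion W n`, and the map
to `H¹(K_v, E)` is `ContinuousCohomology.map` along the compatible pair
`(resGal K_v : Γ_{K_v} → Γ_K, E[n] ↪ E(K̄) → E(K̄_v))`; its kernel is `Literature.NumberTheory.EllipticCurves.resKer`. No Kummer map
enters the definition: that this group *equals* the classical Kummer-condition Selmer group
`{ξ ∈ H¹(K, E[n]) | res_v ξ ∈ im (E(K_v)/n ↪ H¹(K_v, E[n])) ∀ v}` (Silverman, *AEC*, X.4.2;
Milne, *ADT*, I.§6) is the content of the exactness of `0 → E(K_v)/n → H¹(K_v, E[n]) → H¹(K_v, E)[n]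
→ 0`, and the fundamental sequence `0 → E(K)/nE(K) → Sel^(n) → Ш[n] → 0` is recorded as the theorems
`exists_kummerMap`, `map_torsionH1ToH1_selmerGroup`. The `p^∞`-Selmer group is defined likewise
with `E[p^∞] = geomPrimaryTorsion W p`.

The `ℤ_p`-corank of a cofinitely generated `p`-primary group `A ≅ (ℚ_p/ℤ_p)^r ⊕ (finite)` is
computed by the formula `r = dim_{𝔽_p} A[p] − dim_{𝔽_p} A/pA` (`Literature.NumberTheory.EllipticCurves.zpCorank`); the Selmer and
Ш coranks give the inequality/identity `corank Sel_{p^∞} = rank E(K) + corank Ш[p^∞]`.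

Sources: Silverman, *AEC*, X.§4 (Def. of `Sel^(n)`, Thm. X.4.2); Milne, *Arithmetic Duality
Theorems*, I.§6; Cassels (1962–66), *Arithmetic on curves of genus 1* IV, VIII; Greenberg (1999),
*Iwasawa theory for elliptic curves*, §1–2 (coranks).

## Mathlib reuse

`continuousCohomology`, `ContinuousCohomology.map`, `ContinuousMonoidHom.id`,
`HeightOneSpectrum.adicCompletion`, `NumberField.InfinitePlace.Completion`, `AddSubgroup.torsionBy`
(with `AddSubgroup.torsionBy.zmodModule`), `AddCommGroup.primaryComponent`, `ModN A p = A/pA` (with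
its `ZMod p`-module instance, `Mathlib.LinearAlgebra.FreeModule.ModN`), `Module.finrank`,
`zsmulAddGroupHom`. Mathlib's only `selmerGroup` is `IsDedekindDomain.HeightOneSpectrum.selmerGroup`
(the Selmer group of a *number field*), so there is no name clash with `WeierstrassCurve.selmerGroup`.
Bloch–Kato Selmer groups `H¹_f` are deferred to the `PAdicHodge` file of group G09 (remark only).

## Design choices

* Group-wide rules: `noncomputable section`, `open scoped Classical`, no `[DecidableEq]` variables;
  one named universe `u` with `K E : Type u` (forced by `ContinuousCohomology.map`).
* Local conditions are indexed by an arbitrary `K`-field `E` (instantiated at completions), as in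
  `Sha`; the Selmer group is the intersection over the two index types of places.
* `zpCorank` uses `ℕ`-subtraction; documented as meaningful only for cofinitely generated
  `p`-primary groups, where `dim A[p] ≥ dim A/pA`. `shaCorank` is the corank of the `p`-primary
  part `Ш[p^∞] = AddCommGroup.primaryComponent Ш p`.
* Declarations about Weierstrass curves (`galH1Torsion`, `selmerGroup`, …) are deliberate
  dot-notation extensions in `namespace WeierstrassCurve`; the generic `zpCorank` lives in
  `namespace Literature`.
-/

noncomputable section

open scoped Classical
open scoped AddSubgroup

open NumberField IsDedekindDomain

universe u

/-! ## The `ℤ_p`-corank of a `p`-primary abelian group -/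

namespace Literature.NumberTheory.EllipticCurves

/-- The `ℤ_p`-corank of an abelian group `A`, by the formula
`dim_{𝔽_p} A[p] − dim_{𝔽_p} (A / pA)` (with `A[p] = AddSubgroup.torsionBy A p` a `ZMod p`-module via
`AddSubgroup.torsionBy.zmodModule`, and `A/pA = ModN A p`). This is meaningful ONLY for cofinitely
generated `p`-primary groups `A ≅ (ℚ_p/ℤ_p)^r ⊕ B` with `B` finite, for which `dim A[p] = r + dim B[p]`
and `dim A/pA = dim B/pB = dim B[p]`, so the value is the corank `r`; for other groups (and because
of `ℕ`-subtraction and the junk value `0` of `finrank` in infinite dimension) the value is junk.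
Greenberg (1999), *Iwasawa theory for elliptic curves*, §1; Milne, *ADT*, I.§6. [cite: Greenberg1999] -/
def zpCorank (A : Type*) [AddCommGroup A] (p : ℕ) : ℕ :=
  letI : Module (ZMod p) A[(p : ℤ)] := AddSubgroup.torsionBy.zmodModule
  Module.finrank (ZMod p) A[(p : ℤ)] - Module.finrank (ZMod p) (ModN A p)

end Literature.NumberTheory.EllipticCurves

namespace WeierstrassCurve

open Literature.NumberTheory.EllipticCurves

variable {K : Type u} [Field K] (W : WeierstrassCurve K)

/-! ## `H¹(K, E[n])`, `H¹(K, E[p^∞])` and the local kernels -/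

/-- The Galois cohomology group `H¹(K, E[n]) = H¹_cont(Γ_K, E(K̄)[n])` (Mathlib's
`continuousCohomology 1` of the discrete `Γ_K`-module `geomTorsion W n`, as a type).
Silverman, *AEC*, X.§4 (before Thm. X.4.2); Milne, *ADT*, I.§6. [folklore] -/
abbrev galH1Torsion (n : ℤ) : Type u :=
  discreteH1 (Field.absoluteGaloisGroup K) (geomTorsion W n)

/-- The Galois cohomology group `H¹(K, E[p^∞]) = H¹_cont(Γ_K, E(K̄)[p^∞])` (continuous cohomology
of the discrete `Γ_K`-module `geomPrimaryTorsion W p`, action `Literature.NumberTheory.EllipticCurves.primaryComponent.instDistribMulAction`).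
Greenberg (1999), §2; Milne, *ADT*, I.§6. [cite: Greenberg1999] -/
abbrev galH1Primary (p : ℕ) : Type u :=
  discreteH1 (Field.absoluteGaloisGroup K) (geomPrimaryTorsion W p)

variable (E : Type u) [Field E] [Algebra K E]

/-- The local kernel at a `K`-field `E` (a completion `K_v`): the kernel of
`H¹(K, E[n]) → H¹(E, E(K̄_E))` induced by the compatible pair `(resGal E, pointsMap ∘ (E[n] ↪ E(K̄)))`
for the chosen embedding `closureEmb E : K̄ → K̄_E`. Silverman, *AEC*, X.§4; Milne, *ADT*, I.§6. [folklore] -/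
def selmerLocalKer (n : ℤ) : AddSubgroup (galH1Torsion W n) :=
  resKer (resGal (K := K) E) ((pointsMap W E).comp (geomTorsion W n).subtype) fun σ P ↦ by
    simp only [AddMonoidHom.coe_comp, AddSubgroup.coe_subtype, Function.comp_apply,
      Literature.NumberTheory.EllipticCurves.AddSubgroup.torsionBy.coe_smul]
    exact pointsMap_smul W E σ P

/-- The local kernel at `E` attached to an arbitrary `K`-embedding `ι : K̄ → K̄_E`: the kernel of
`H¹(K, E[n]) → H¹(E, E(K̄_E))` along `(resGalOfEmb ι, pointsMapOfEmb ι ∘ (E[n] ↪ E(K̄)))`.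
Silverman, *AEC*, X.§4 (Remark 4.1.1). [folklore] -/
def selmerLocalKerOfEmb (ι : AlgebraicClosure K →ₐ[K] AlgebraicClosure E) (n : ℤ) :
    AddSubgroup (galH1Torsion W n) :=
  resKer (resGalOfEmb ι) ((pointsMapOfEmb W ι).comp (geomTorsion W n).subtype) fun σ P ↦ by
    simp only [AddMonoidHom.coe_comp, AddSubgroup.coe_subtype, Function.comp_apply,
      Literature.NumberTheory.EllipticCurves.AddSubgroup.torsionBy.coe_smul]
    exact pointsMapOfEmb_smul W ι σ P

/-- `selmerLocalKer W E n` is `selmerLocalKerOfEmb W E (closureEmb E) n` (definitional).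
Silverman, *AEC*, X.§4. [folklore] -/
theorem selmerLocalKer_eq_ofEmb (n : ℤ) :
    selmerLocalKer W E n = selmerLocalKerOfEmb W E (closureEmb (K := K) E) n :=
  rfl

/-- Independence of the embedding: the local kernel of `H¹(K, E[n]) → H¹(E, E)` does not depend on
the `K`-embedding `K̄ → K̄_E` (two embeddings differ by `τ ∈ Γ_K`, and conjugation by `τ` is trivial
on `H¹(Γ_K, ·)`: inner automorphisms act trivially on group cohomology). Serre, *Local Fields*,
VII.§5, Prop. 3; Serre, *Galois Cohomology*, I.§2.4, II.§1.1; Silverman, *AEC*, X.§4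
(Remark 4.1.1). [cite: SerreLocalFields1979, VII.§5 Prop. 3] -/
def selmerLocalKer_eq_of_algHom : Prop :=
  ∀ (ι : AlgebraicClosure K →ₐ[K] AlgebraicClosure E) (n : ℤ),
    selmerLocalKerOfEmb W E ι n = selmerLocalKer W E n

/-- The `p^∞` local kernel at `E`: the kernel of `H¹(K, E[p^∞]) → H¹(E, E(K̄_E))` induced by
`(resGal E, pointsMap ∘ (E[p^∞] ↪ E(K̄)))`. Greenberg (1999), §2; Milne, *ADT*, I.§6. [cite: Greenberg1999] -/
def selmerLocalKerPrimary (p : ℕ) : AddSubgroup (galH1Primary W p) :=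
  resKer (resGal (K := K) E) ((pointsMap W E).comp (geomPrimaryTorsion W p).subtype) fun σ P ↦ by
    simp only [AddMonoidHom.coe_comp, AddSubgroup.coe_subtype, Function.comp_apply,
      Literature.NumberTheory.EllipticCurves.primaryComponent.coe_smul]
    exact pointsMap_smul W E σ P

variable {E}

/-! ## The map `H¹(K, E[n]) → H¹(K, E)` -/

/-- The map `H¹(K, E[n]) → H¹(K, E)` induced by the inclusion `E[n] ↪ E(K̄)` (Mathlib's
`ContinuousCohomology.map` along `(id : Γ_K → Γ_K, E[n] ↪ E(K̄))`), as an additive homomorphism.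
Its image is `H¹(K, E)[n]` and its kernel is `E(K)/nE(K)` (Kummer sequence).
Silverman, *AEC*, X.§4 (proof of X.4.2), VIII.§2. [folklore] -/
def torsionH1ToH1 (n : ℤ) : galH1Torsion W n →+ W.galH1 :=
  (ContinuousCohomology.map (ContinuousMonoidHom.id (Field.absoluteGaloisGroup K))
    (resHomOfEquivariant (ContinuousMonoidHom.id (Field.absoluteGaloisGroup K))
      (geomTorsion W n).subtype (fun _ _ ↦ rfl)) 1).hom.toLinearMap.toAddMonoidHom

/-! ## Selmer groups over a number field -/

section NumberField

variable [NumberField K]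

/-- The **`n`-Selmer group** `Sel^(n)(E/K) ⊆ H¹(K, E[n])` of `W` over the number field `K`: the
classes whose image in `H¹(K_v, E)` vanishes for every finite place `v` (`K_v = v.adicCompletion K`)
and every infinite place `w` (`K_w = w.Completion`). Equal to the Kummer-condition Selmer group of
Silverman, *AEC*, X.§4 (Def. before X.4.2) and Milne, *ADT*, I.§6, by exactness of the local Kummer
sequences. [folklore] -/
def selmerGroup (n : ℤ) : AddSubgroup (galH1Torsion W n) :=
  (⨅ v : HeightOneSpectrum (𝓞 K), selmerLocalKer W (v.adicCompletion K) n) ⊓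
    ⨅ w : InfinitePlace K, selmerLocalKer W w.Completion n

/-- Membership in `Sel^(n)(E/K)`: a class lies in the Selmer group iff it dies in `H¹(K_v, E)` for
all finite `v` and all infinite `w`. Silverman, *AEC*, X.§4. [folklore] -/
theorem mem_selmerGroup_iff (n : ℤ) (c : galH1Torsion W n) :
    c ∈ selmerGroup W n ↔
      (∀ v : HeightOneSpectrum (𝓞 K), c ∈ selmerLocalKer W (v.adicCompletion K) n) ∧
        ∀ w : InfinitePlace K, c ∈ selmerLocalKer W w.Completion n := by
  simp only [selmerGroup, AddSubgroup.mem_inf, AddSubgroup.mem_iInf]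

/-- The **`p^∞`-Selmer group** `Sel_{p^∞}(E/K) ⊆ H¹(K, E[p^∞])`: the classes dying in `H¹(K_v, E)`
at every place. Greenberg (1999), §2; Milne, *ADT*, I.§6. [cite: Greenberg1999] -/
def selmerGroupPInfty (p : ℕ) : AddSubgroup (galH1Primary W p) :=
  (⨅ v : HeightOneSpectrum (𝓞 K), selmerLocalKerPrimary W (v.adicCompletion K) p) ⊓
    ⨅ w : InfinitePlace K, selmerLocalKerPrimary W w.Completion p

/-- `Sel^(n)(E/K)` does not depend on the choices of embeddings `K̄ → K̄_v`.
Silverman, *AEC*, X.§4 (Remark 4.1.1). [folklore] -/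
def selmerGroup_eq_of_algHom : Prop :=
  ∀ (n : ℤ)
    (ι : ∀ v : HeightOneSpectrum (𝓞 K),
      AlgebraicClosure K →ₐ[K] AlgebraicClosure (v.adicCompletion K))
    (ι' : ∀ w : InfinitePlace K, AlgebraicClosure K →ₐ[K] AlgebraicClosure w.Completion),
    selmerGroup W n = (⨅ v : HeightOneSpectrum (𝓞 K), selmerLocalKerOfEmb W _ (ι v) n) ⊓
      ⨅ w : InfinitePlace K, selmerLocalKerOfEmb W _ (ι' w) n

/- interim proof relied on results that are now named facts (D-0014); demoted to a fact by the M5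
import, proof preserved:
:= by
  simp only [selmerGroup, selmerLocalKer_eq_of_algHom]
-/

/-- The `ℤ_p`-corank of the `p^∞`-Selmer group `Sel_{p^∞}(E/K)` (a cofinitely generated
`p`-primary group). Greenberg (1999), §1–2. [cite: Greenberg1999] -/
def selmerCorank (p : ℕ) : ℕ :=
  zpCorank (selmerGroupPInfty W p) p

/-- The `ℤ_p`-corank of the `p`-primary part `Ш(E/K)[p^∞] = AddCommGroup.primaryComponent Ш p` of the
Tate–Shafarevich group (a cofinitely generated `p`-primary group; conjecturally finite, i.e. of
corank `0`). Greenberg (1999), §1; Milne, *ADT*, I.§6. [cite: Greenberg1999] -/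
def shaCorank (p : ℕ) : ℕ :=
  zpCorank (AddCommGroup.primaryComponent W.sha p) p

/-! ## The fundamental exact sequence and finiteness -/

/-- The image of `Sel^(n)(E/K)` under `H¹(K, E[n]) → H¹(K, E)` is `Ш(E/K)[n]` (surjectivity of
`Sel^(n) → Ш[n]` in `0 → E(K)/nE(K) → Sel^(n)(E/K) → Ш(E/K)[n] → 0`).
Silverman, *AEC*, X.4.2(a); Milne, *ADT*, I.§6 (Kummer sequence).
[cite: SilvermanAEC2009, Thm X.4.2(a)] -/
def map_torsionH1ToH1_selmerGroup : Prop :=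
  ∀ {n : ℤ} (hn : n ≠ 0),
    (selmerGroup W n).map (torsionH1ToH1 W n) = W.sha ⊓ AddSubgroup.torsionBy W.galH1 n

/-- The Kummer map: for `n ≠ 0` there is a homomorphism `κ : E(K) → H¹(K, E[n])`
(`P ↦ (σ ↦ σQ − Q)`, `nQ = P`) with kernel `nE(K)` and image `Sel^(n)(E/K) ∩ ker (H¹(K, E[n]) →
H¹(K, E))`, i.e. `0 → E(K)/nE(K) → Sel^(n)(E/K) → Ш(E/K)[n] → 0` is exact.
Silverman, *AEC*, VIII.§2 (Kummer sequence) and X.4.2(a); Milne, *ADT*, I.§6.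
[cite: SilvermanAEC2009, §VIII.2 and Thm X.4.2(a)] -/
def exists_kummerMap : Prop :=
  ∀ {n : ℤ} (hn : n ≠ 0),
    ∃ κ : W.toAffine.Point →+ galH1Torsion W n,
      κ.ker = (zsmulAddGroupHom (α := W.toAffine.Point) n).range ∧
        κ.range = selmerGroup W n ⊓ (torsionH1ToH1 W n).ker

/-- Finiteness of the `n`-Selmer group of an elliptic curve over a number field (`n ≠ 0`); this is
the heart of the weak Mordell–Weil theorem. Silverman, *AEC*, X.4.2(b); Milne, *ADT*, I.6.6.
[cite: SilvermanAEC2009, Thm X.4.2(b)] -/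
def finite_selmerGroup : Prop :=
  ∀ [W.IsElliptic] {n : ℤ} (hn : n ≠ 0),
    Finite (selmerGroup W n)

/-- Corank identity: `corank_{ℤ_p} Sel_{p^∞}(E/K) = rank E(K) + corank_{ℤ_p} Ш(E/K)[p^∞]`, from
`0 → E(K) ⊗ ℚ_p/ℤ_p → Sel_{p^∞}(E/K) → Ш(E/K)[p^∞] → 0`.
Greenberg (1999), §1 (p. 53); Milne, *ADT*, I.§6. [cite: Greenberg1999] -/
def selmerCorank_eq_mordellWeilRank_add : Prop :=
  ∀ [W.IsElliptic] (p : ℕ) [Fact p.Prime],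
    selmerCorank W p = W.mordellWeilRank + shaCorank W p

end NumberField

end WeierstrassCurve
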